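import Summits.Ventures.CertifiedManyBodySolver.Theorems.TcThermcert1QbpSectorBookkeeping
import Mathlib
import HarnessLib

/-!
# `TcThermcert1` — QBP chain, PART 7c (torus data): the seam-pair family and the degree of the fermion torus

Model-side data for the leakage estimate `norm_heisenbergEvolution_sub_restricted_le_of_supported` (PART 7c,
`TcThermcert1QbpLiebRobinsonSupported`) applied to the seam-augmented dynamics `H_T + sV` of stub B
(`V = seamTwist L θ`, `H_T` = Hubbard terms kept in a collar `T` of the seam):
* §1 the SEAM PAIRS `q_{y,σ} = Σ_b (1 − e^{±iθ}) c†c` (the `(y, σ)`-slice of `seamTwist_eq`): `seamTwist L θ = Σ_{y,σ} q`,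
  each `q` is Hermitian, even, supported on the two seam sites `{(0,y), (−1,y)}`, and `‖q‖ ≤ 2|θ|`;
* §2 the seam-augmented family on `HubbardIdx G ⊕ (ZMod L × Fin 2)`: its sum is `H(0) + sV` (all terms) resp.
  `H_T + sV` (collar terms), every member is Hermitian, even-local and of norm `≤ 2 + |U| + 2|θ|` for `s ∈ [0, 1]`;
* §3 geometry: the two seam sites of a pair are equal or adjacent, every site of the fermion torus has at most `2d`
  neighbours, and at most `2|W|` seam pairs meet a set of sites `W`.
Sources: Watanabe, J. Stat. Phys. 177 (2019) 717, §2.2.3/§4.1 (twist operator on the seam); Hastings–Koma 2006 App. A;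
Capel–Moscolari–Teufel–Wessel, arXiv:2310.09182, Thm. 14.  SC in the Hubbard model is NOT proved by anything here.
-/

noncomputable section

open Matrix Finset
open Literature.MathematicalPhysics.QuantumLattice
open Literature.Probability.LatticeModels

namespace Summit.Ventures.CertifiedManyBodySolver.Theorems.TcThermcert1.GaugeQbpFarSeam

section GenericHopping

variable {Λ : Type*} [LinearOrder Λ] [Fintype Λ]

/-- A sum of weighted hoppings between sites of `X` is even and supported in `X` (generic in the lattice, so that no
instance of a concrete lattice is re-synthesised when it is applied). [folklore] -/
theorem sum_smul_hopping_mem_carEvenSubalgebra {γ : Type*} [Fintype γ] (c : γ → ℂ) (a b : γ → Λ)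
    (σ τ : γ → Fin 2) {X : Finset Λ} (ha : ∀ k, a k ∈ X) (hb : ∀ k, b k ∈ X) :
    (∑ k, c k • (creation (orb (a k) (σ k)) * annihilation (orb (b k) (τ k))) :
      Matrix (Finset (Orb Λ)) (Finset (Orb Λ)) ℂ) ∈ carEvenSubalgebra (orbSet X) :=
  Subalgebra.sum_mem _ fun k _ => Subalgebra.smul_mem _ (hopping_mem_carEvenSubalgebra_orbSet (ha k) (hb k) _ _) _

/-- Scalar multiples stay in the even algebra of `X` (generic wrapper of `Subalgebra.smul_mem`). [folklore] -/
theorem smul_mem_carEvenSubalgebra_orbSet {X : Finset Λ} {A : Matrix (Finset (Orb Λ)) (Finset (Orb Λ)) ℂ}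
    (hA : A ∈ carEvenSubalgebra (orbSet X)) (s : ℂ) : s • A ∈ carEvenSubalgebra (orbSet X) :=
  Subalgebra.smul_mem _ hA s

end GenericHopping

section SeamPairs

variable (L : ℕ) [NeZero L]

/-- `seamTwist L θ` is the sum over `(y, σ)` of the seam pairs `Σ_b (1 − e^{±iθ}) c†_{(b?0:−1, y)σ} c_{(b?−1:0, y)σ}`.
[cite: Watanabe2019, §2.2.3 and §4.1] -/
theorem seamTwist_eq_sum_seamPair (θ : ℝ) :
    seamTwist L θ = ∑ p : ZMod L × Fin 2, ∑ b : Bool,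
      (1 - Complex.exp ((if b then 1 else -1) * Complex.I * θ)) •
        (creation (orb (FermionTorus.ofTorusSite (![if b then 0 else -1, p.1] : TorusSite 2 L)) p.2) *
          annihilation (orb (FermionTorus.ofTorusSite (![if b then -1 else 0, p.1] : TorusSite 2 L)) p.2)) := by
  rw [seamTwist_eq, Fintype.sum_prod_type]

/-- The conjugate of the seam coefficient: `conj (1 − e^{±iθ}) = 1 − e^{∓iθ}`. [folklore] -/
theorem star_one_sub_cexp_seamCoeff (θ : ℝ) (b : Bool) :
    star ((1 : ℂ) - Complex.exp ((if b then 1 else -1) * Complex.I * θ)) =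
      1 - Complex.exp ((if !b then 1 else -1) * Complex.I * θ) := by
  rw [Complex.star_def, map_sub, map_one, ← Complex.exp_conj, map_mul, map_mul, Complex.conj_I,
    Complex.conj_ofReal]
  cases b <;> simp

/-- **Each seam pair is Hermitian** (the `b = false` summand is the adjoint of the `b = true` one).
[cite: Watanabe2019, §2.2.3 and §4.1] -/
theorem isHermitian_seamPair (θ : ℝ) (y : ZMod L) (σ : Fin 2) :
    (∑ b : Bool, (1 - Complex.exp ((if b then 1 else -1) * Complex.I * θ)) •
        (creation (orb (FermionTorus.ofTorusSite (![if b then 0 else -1, y] : TorusSite 2 L)) σ) *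
          annihilation (orb (FermionTorus.ofTorusSite (![if b then -1 else 0, y] : TorusSite 2 L)) σ))).IsHermitian := by
  unfold Matrix.IsHermitian
  rw [conjTranspose_sum, Fintype.sum_bool, Fintype.sum_bool, add_comm]
  simp only [conjTranspose_smul, conjTranspose_mul, creation_conjTranspose, annihilation_conjTranspose]
  simp [← Complex.exp_conj, Complex.conj_ofReal]

/-- Each seam pair is even and supported on its two seam sites. [cite: Watanabe2019, §2.2.3 and §4.1] -/
theorem seamPair_mem_carEvenSubalgebra (θ : ℝ) (y : ZMod L) (σ : Fin 2) :
    (∑ b : Bool, (1 - Complex.exp ((if b then 1 else -1) * Complex.I * θ)) •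
        (creation (orb (FermionTorus.ofTorusSite (![if b then 0 else -1, y] : TorusSite 2 L)) σ) *
          annihilation (orb (FermionTorus.ofTorusSite (![if b then -1 else 0, y] : TorusSite 2 L)) σ))) ∈
      carEvenSubalgebra (orbSet ({FermionTorus.ofTorusSite (![0, y] : TorusSite 2 L),
        FermionTorus.ofTorusSite (![-1, y] : TorusSite 2 L)} : Finset (FermionTorus 2 L))) := by
  have h0 : FermionTorus.ofTorusSite (![0, y] : TorusSite 2 L) ∈
      ({FermionTorus.ofTorusSite (![0, y] : TorusSite 2 L), FermionTorus.ofTorusSite (![-1, y] : TorusSite 2 L)} :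
        Finset (FermionTorus 2 L)) := Finset.mem_insert_self _ _
  have h1 : FermionTorus.ofTorusSite (![-1, y] : TorusSite 2 L) ∈
      ({FermionTorus.ofTorusSite (![0, y] : TorusSite 2 L), FermionTorus.ofTorusSite (![-1, y] : TorusSite 2 L)} :
        Finset (FermionTorus 2 L)) := Finset.mem_insert_of_mem (Finset.mem_singleton_self _)
  refine sum_smul_hopping_mem_carEvenSubalgebra
    (fun b : Bool => (1 - Complex.exp ((if b then 1 else -1) * Complex.I * θ)))
    (fun b => FermionTorus.ofTorusSite (![if b then 0 else -1, y] : TorusSite 2 L))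
    (fun b => FermionTorus.ofTorusSite (![if b then -1 else 0, y] : TorusSite 2 L)) (fun _ => σ) (fun _ => σ) ?_ ?_
  · intro b
    cases b
    · simp [h1]
    · simp [h0]
  · intro b
    cases b
    · simp [h0]
    · simp [h1]

end SeamPairs

section SeamPairNorm

open scoped Matrix.Norms.L2Operator

variable (L : ℕ) [NeZero L]

/-- `‖q_{y,σ}‖ ≤ 2|θ|` (`|1 − e^{±iθ}| ≤ |θ|`, `‖c†c‖ ≤ 1`). [cite: Watanabe2019, §2.2.3 and §4.1] -/
theorem norm_seamPair_le (θ : ℝ) (y : ZMod L) (σ : Fin 2) :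
    ‖∑ b : Bool, (1 - Complex.exp ((if b then 1 else -1) * Complex.I * θ)) •
        (creation (orb (FermionTorus.ofTorusSite (![if b then 0 else -1, y] : TorusSite 2 L)) σ) *
          annihilation (orb (FermionTorus.ofTorusSite (![if b then -1 else 0, y] : TorusSite 2 L)) σ))‖ ≤ 2 * |θ| := by
  refine (norm_sum_le _ _).trans ?_
  have hb : ∀ b : Bool, ‖(1 - Complex.exp ((if b then 1 else -1) * Complex.I * θ)) •
      (creation (orb (FermionTorus.ofTorusSite (![if b then 0 else -1, y] : TorusSite 2 L)) σ) *
        annihilation (orb (FermionTorus.ofTorusSite (![if b then -1 else 0, y] : TorusSite 2 L)) σ))‖ ≤ |θ| := by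
    intro b
    rw [norm_smul]
    exact (mul_le_mul (norm_one_sub_cexp_seamCoeff_le_abs θ b) (norm_creation_mul_annihilation_le_one _ _)
      (norm_nonneg _) (abs_nonneg θ)).trans (mul_one _).le
  calc ∑ b : Bool, ‖(1 - Complex.exp ((if b then 1 else -1) * Complex.I * θ)) •
        (creation (orb (FermionTorus.ofTorusSite (![if b then 0 else -1, y] : TorusSite 2 L)) σ) *
          annihilation (orb (FermionTorus.ofTorusSite (![if b then -1 else 0, y] : TorusSite 2 L)) σ))‖
      ≤ ∑ _b : Bool, |θ| := Finset.sum_le_sum fun b _ => hb b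
    _ = 2 * |θ| := by rw [Finset.sum_const, Finset.card_univ, Fintype.card_bool]; simp [two_mul]

/-! ### §2 The seam-augmented family -/

/-- **The seam-augmented family sums to `H(0) + sV`**: over `HubbardIdx G ⊕ (ZMod L × Fin 2)`, Hubbard terms on the
left summands and `s`-scaled seam pairs on the right. [cite: Watanabe2019, §2.2.3 and §4.1] -/
theorem sum_seamAugmented_eq (U θ s : ℝ) :
    ∑ Z : HubbardIdx (fermionTorusGraph 2 L) ⊕ (ZMod L × Fin 2),
      Sum.elim (hubbardTermOp (fermionTorusGraph 2 L) 1 U 0)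
        (fun p => (s : ℂ) • ∑ b : Bool, (1 - Complex.exp ((if b then 1 else -1) * Complex.I * θ)) •
          (creation (orb (FermionTorus.ofTorusSite (![if b then 0 else -1, p.1] : TorusSite 2 L)) p.2) *
            annihilation (orb (FermionTorus.ofTorusSite (![if b then -1 else 0, p.1] : TorusSite 2 L)) p.2))) Z =
      hubbardTorusTT'Flux L 0 U 0 + (s : ℂ) • seamTwist L θ := by
  rw [Fintype.sum_sum_type]
  simp only [Sum.elim_inl, Sum.elim_inr]
  rw [← Finset.smul_sum, ← seamTwist_eq_sum_seamPair, hubbardTorusTT'Flux_zero_zero_eq_sum_hubbardTermOp]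

/-- **The collar part of the seam-augmented family sums to `H_T + sV`** (`T.disjSum univ`: the kept Hubbard terms and
all seam pairs). [cite: Watanabe2019, §2.2.3 and §4.1] -/
theorem sum_seamAugmented_disjSum_eq (U θ s : ℝ) (T : Finset (HubbardIdx (fermionTorusGraph 2 L))) :
    ∑ Z ∈ T.disjSum (Finset.univ : Finset (ZMod L × Fin 2)),
      Sum.elim (hubbardTermOp (fermionTorusGraph 2 L) 1 U 0)
        (fun p => (s : ℂ) • ∑ b : Bool, (1 - Complex.exp ((if b then 1 else -1) * Complex.I * θ)) •
          (creation (orb (FermionTorus.ofTorusSite (![if b then 0 else -1, p.1] : TorusSite 2 L)) p.2) *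
            annihilation (orb (FermionTorus.ofTorusSite (![if b then -1 else 0, p.1] : TorusSite 2 L)) p.2))) Z =
      ∑ Z ∈ T, hubbardTermOp (fermionTorusGraph 2 L) 1 U 0 Z + (s : ℂ) • seamTwist L θ := by
  rw [Finset.sum_disjSum]
  simp only [Sum.elim_inl, Sum.elim_inr]
  rw [← Finset.smul_sum, ← seamTwist_eq_sum_seamPair]

/-- Every member of the seam-augmented family is Hermitian (`s` real). [cite: Watanabe2019, §2.2.3 and §4.1] -/
theorem isHermitian_seamAugmented (U θ s : ℝ) (Z : HubbardIdx (fermionTorusGraph 2 L) ⊕ (ZMod L × Fin 2)) :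
    (Sum.elim (hubbardTermOp (fermionTorusGraph 2 L) 1 U 0)
        (fun p => (s : ℂ) • ∑ b : Bool, (1 - Complex.exp ((if b then 1 else -1) * Complex.I * θ)) •
          (creation (orb (FermionTorus.ofTorusSite (![if b then 0 else -1, p.1] : TorusSite 2 L)) p.2) *
            annihilation (orb (FermionTorus.ofTorusSite (![if b then -1 else 0, p.1] : TorusSite 2 L)) p.2))) Z).IsHermitian := by
  cases Z with
  | inl Z => exact isHermitian_hubbardTermOp _ 1 U 0 Z
  | inr p =>
    simp only [Sum.elim_inr]
    unfold Matrix.IsHermitian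
    rw [conjTranspose_smul, Complex.star_def, Complex.conj_ofReal, (isHermitian_seamPair L θ p.1 p.2).eq]

/-- Every member of the seam-augmented family is even and supported on its support (`hubbardTermSupp` on the left,
the two seam sites on the right). [cite: Watanabe2019, §2.2.3 and §4.1] -/
theorem seamAugmented_mem_carEvenSubalgebra (U θ s : ℝ) (Z : HubbardIdx (fermionTorusGraph 2 L) ⊕ (ZMod L × Fin 2)) :
    Sum.elim (hubbardTermOp (fermionTorusGraph 2 L) 1 U 0)
        (fun p => (s : ℂ) • ∑ b : Bool, (1 - Complex.exp ((if b then 1 else -1) * Complex.I * θ)) •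
          (creation (orb (FermionTorus.ofTorusSite (![if b then 0 else -1, p.1] : TorusSite 2 L)) p.2) *
            annihilation (orb (FermionTorus.ofTorusSite (![if b then -1 else 0, p.1] : TorusSite 2 L)) p.2))) Z ∈
      carEvenSubalgebra (orbSet (Sum.elim (hubbardTermSupp (fermionTorusGraph 2 L))
        (fun p => ({FermionTorus.ofTorusSite (![0, p.1] : TorusSite 2 L),
          FermionTorus.ofTorusSite (![-1, p.1] : TorusSite 2 L)} : Finset (FermionTorus 2 L))) Z)) := by
  cases Z with
  | inl Z => exact hubbardTermOp_mem_carEvenSubalgebra _ 1 U 0 Z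
  | inr p => exact smul_mem_carEvenSubalgebra_orbSet (seamPair_mem_carEvenSubalgebra L θ p.1 p.2) _

/-- Every member of the seam-augmented family has norm `≤ 2 + |U| + 2|θ|` when `s ∈ [0, 1]` (uniformity in the QBP
parameter). [cite: Watanabe2019, §2.2.3 and §4.1] -/
theorem norm_seamAugmented_le (U θ : ℝ) {s : ℝ} (hs : s ∈ Set.Icc (0 : ℝ) 1)
    (Z : HubbardIdx (fermionTorusGraph 2 L) ⊕ (ZMod L × Fin 2)) :
    ‖Sum.elim (hubbardTermOp (fermionTorusGraph 2 L) 1 U 0)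
        (fun p => (s : ℂ) • ∑ b : Bool, (1 - Complex.exp ((if b then 1 else -1) * Complex.I * θ)) •
          (creation (orb (FermionTorus.ofTorusSite (![if b then 0 else -1, p.1] : TorusSite 2 L)) p.2) *
            annihilation (orb (FermionTorus.ofTorusSite (![if b then -1 else 0, p.1] : TorusSite 2 L)) p.2))) Z‖ ≤
      2 + |U| + 2 * |θ| := by
  cases Z with
  | inl Z =>
    simp only [Sum.elim_inl]
    have h := norm_hubbardTermOp_le (fermionTorusGraph 2 L) 1 U 0 Z
    rw [abs_one, mul_one, abs_zero, mul_zero, add_zero] at h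
    exact h.trans (by linarith [abs_nonneg θ])
  | inr p =>
    simp only [Sum.elim_inr]
    rw [norm_smul, Complex.norm_real, Real.norm_eq_abs, abs_of_nonneg hs.1]
    have h := norm_seamPair_le L θ p.1 p.2
    have h1 : s * ‖∑ b : Bool, (1 - Complex.exp ((if b then 1 else -1) * Complex.I * θ)) •
        (creation (orb (FermionTorus.ofTorusSite (![if b then 0 else -1, p.1] : TorusSite 2 L)) p.2) *
          annihilation (orb (FermionTorus.ofTorusSite (![if b then -1 else 0, p.1] : TorusSite 2 L)) p.2))‖ ≤
        1 * (2 * |θ|) := mul_le_mul hs.2 h (norm_nonneg _) zero_le_one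
    linarith [abs_nonneg U]

end SeamPairNorm

/-! ### §3 Geometry of the fermion torus -/

section Geometry

variable (L : ℕ) [NeZero L]

/-- **The two sites of a seam pair are equal or adjacent** (`(0, y) = (−1, y) + e₁`; they coincide only for `L = 1`).
[cite: FriedliVelenik2017, §3.1] -/
theorem seamSites_eq_or_adj (y : ZMod L) :
    FermionTorus.ofTorusSite (![0, y] : TorusSite 2 L) = FermionTorus.ofTorusSite (![-1, y] : TorusSite 2 L) ∨
      (fermionTorusGraph 2 L).Adj (FermionTorus.ofTorusSite (![0, y] : TorusSite 2 L))
        (FermionTorus.ofTorusSite (![-1, y] : TorusSite 2 L)) := by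
  by_cases h : FermionTorus.ofTorusSite (![0, y] : TorusSite 2 L) = FermionTorus.ofTorusSite (![-1, y] : TorusSite 2 L)
  · exact Or.inl h
  · refine Or.inr ?_
    rw [fermionTorusGraph_adj, FermionTorus.toTorusSite_ofTorusSite, FermionTorus.toTorusSite_ofTorusSite,
      torusGraph_adj_iff]
    refine ⟨fun he => h (congrArg FermionTorus.ofTorusSite he), Or.inr ⟨0, ?_⟩⟩
    ext i
    fin_cases i <;> simp

/-- The `hadj` datum of `fermion_lieb_robinson_supported` for a seam-pair support: any two of its sites are equal or
adjacent. [cite: FriedliVelenik2017, §3.1] -/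
theorem eq_or_adj_of_mem_seamSites (y : ZMod L) {z w : FermionTorus 2 L}
    (hz : z ∈ ({FermionTorus.ofTorusSite (![0, y] : TorusSite 2 L), FermionTorus.ofTorusSite (![-1, y] : TorusSite 2 L)} :
      Finset (FermionTorus 2 L)))
    (hw : w ∈ ({FermionTorus.ofTorusSite (![0, y] : TorusSite 2 L), FermionTorus.ofTorusSite (![-1, y] : TorusSite 2 L)} :
      Finset (FermionTorus 2 L))) :
    z = w ∨ (fermionTorusGraph 2 L).Adj z w := by
  simp only [Finset.mem_insert, Finset.mem_singleton] at hz hw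
  rcases hz with rfl | rfl <;> rcases hw with rfl | rfl
  · exact Or.inl rfl
  · exact seamSites_eq_or_adj L y
  · rcases seamSites_eq_or_adj L y with h | h
    · exact Or.inl h.symm
    · exact Or.inr h.symm
  · exact Or.inl rfl

/-- **Every site of the fermion torus `(ℤ/Lℤ)^d` has at most `2d` neighbours** (`x ± eᵢ`).
[cite: FriedliVelenik2017, §3.1] -/
theorem card_filter_adj_fermionTorusGraph_le (d : ℕ) (x : FermionTorus d L) :
    (Finset.univ.filter fun y => (fermionTorusGraph d L).Adj x y).card ≤ 2 * d := by
  classical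
  let f : Fin d × Bool → FermionTorus d L := fun ib =>
    FermionTorus.ofTorusSite (if ib.2 then FermionTorus.toTorusSite x + Pi.single ib.1 1
      else FermionTorus.toTorusSite x - Pi.single ib.1 1)
  have hsub : (Finset.univ.filter fun y => (fermionTorusGraph d L).Adj x y) ⊆ Finset.univ.image f := by
    intro y hy
    rw [Finset.mem_filter, fermionTorusGraph_adj, torusGraph_adj_iff] at hy
    obtain ⟨-, ⟨i, hi⟩ | ⟨i, hi⟩⟩ := hy.2
    · refine Finset.mem_image.2 ⟨(i, true), Finset.mem_univ _, ?_⟩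
      simp only [f, if_true]
      rw [← hi, FermionTorus.ofTorusSite_toTorusSite]
    · refine Finset.mem_image.2 ⟨(i, false), Finset.mem_univ _, ?_⟩
      simp only [f, Bool.false_eq_true, if_false]
      rw [hi, add_sub_cancel_right, FermionTorus.ofTorusSite_toTorusSite]
  calc (Finset.univ.filter fun y => (fermionTorusGraph d L).Adj x y).card
      ≤ (Finset.univ.image f).card := Finset.card_le_card hsub
    _ ≤ (Finset.univ : Finset (Fin d × Bool)).card := Finset.card_image_le
    _ = 2 * d := by rw [Finset.card_univ, Fintype.card_prod, Fintype.card_fin, Fintype.card_bool, mul_comm]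

/-- **At most `2|W|` seam pairs meet a set of sites `W`**: a pair `(y, σ)` meeting `W` has `y` equal to the second
coordinate of a site of `W`. [folklore] -/
theorem card_filter_seamSites_not_disjoint_le (W : Finset (FermionTorus 2 L)) :
    (Finset.univ.filter fun p : ZMod L × Fin 2 =>
      ¬ Disjoint ({FermionTorus.ofTorusSite (![0, p.1] : TorusSite 2 L),
        FermionTorus.ofTorusSite (![-1, p.1] : TorusSite 2 L)} : Finset (FermionTorus 2 L)) W).card ≤ 2 * W.card := by
  classical
  have hsub : (Finset.univ.filter fun p : ZMod L × Fin 2 =>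
      ¬ Disjoint ({FermionTorus.ofTorusSite (![0, p.1] : TorusSite 2 L),
        FermionTorus.ofTorusSite (![-1, p.1] : TorusSite 2 L)} : Finset (FermionTorus 2 L)) W) ⊆
      (W.image fun w => FermionTorus.toTorusSite w 1) ×ˢ (Finset.univ : Finset (Fin 2)) := by
    intro p hp
    rw [Finset.mem_filter] at hp
    obtain ⟨w, hw1, hw2⟩ := Finset.not_disjoint_iff.1 hp.2
    refine Finset.mem_product.2 ⟨Finset.mem_image.2 ⟨w, hw2, ?_⟩, Finset.mem_univ _⟩
    simp only [Finset.mem_insert, Finset.mem_singleton] at hw1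
    rcases hw1 with rfl | rfl <;> rw [FermionTorus.toTorusSite_ofTorusSite] <;> simp
  calc _ ≤ ((W.image fun w => FermionTorus.toTorusSite w 1) ×ˢ (Finset.univ : Finset (Fin 2))).card :=
        Finset.card_le_card hsub
    _ = (W.image fun w => FermionTorus.toTorusSite w 1).card * 2 := by
        rw [Finset.card_product, Finset.card_univ, Fintype.card_fin]
    _ ≤ W.card * 2 := Nat.mul_le_mul_right _ Finset.card_image_le
    _ = 2 * W.card := mul_comm _ _

end Geometry

end Summit.Ventures.CertifiedManyBodySolver.Theorems.TcThermcert1.GaugeQbpFarSeam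

end
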